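import Mathlib

/-!
# SoloBlind — elementary identities behind the Hecke-sweep splitting test (THEOREM HT, s97)

Kernel-checkable bookkeeping for the soloist note `work/s97/hecke-tangency.md`
(HodgeConjecture solo-blind residency, session s97).  THEOREM HT itself — for every
level `N ≤ 13` and `K ∈ {25, −16, −720}` the polynomial `Ψ_{N,K}(T)` is squarefree, so the
branch hyperbola `t₁t₂ = K` of the conic bundle `Σ_ψ → (t₁,t₂)`-plane meets every Hecke
curve `Φ_N(j(t₁), j(t₂)) = 0` transversally and no isogeny-graph sweep of level `≤ 13` is
`W₀`-visible at the RM points — is a PARI/GP computation (kit jobs j233099, j233122,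
j233145) and is NOT formalised here.  What is checked:

* `hesse_j_sub_1728_square` : with `s = t³`, `s(s+216)³ − 1728(s−27)³ = (s² − 540s − 5832)²`,
  the ramification check that `j(t) = t³(t³+216)³/(t³−27)³` is the Hauptmodul relation of
  the Hesse pencil `u³+v³+w³ = t·uvw` (all points over `j = 1728` doubly ramified);
* `hesse_involution_involutive`, `hesse_involution_swaps_cusps`, `hesse_j_invariant` :
  the level-3 involution `g(t) = (3t+18)/(t−3)` (one of the twelve `PSL₂(𝔽₃)` automorphisms
  of the `t`-line) is an involution, swaps the cusps `3ω ↔ 3ω²` (and `∞ ↔ 3`), and fixes `j`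
  — the cross-multiplied degree-21 identity;
* `level_one_tangency_discriminant`, `level_one_tangency_norm_form`,
  `rm_points_not_level_one_tangent` : the planted positive of the test — the component
  `t₂ = g(t₁)` of the level-1 Hecke curve meets `t₁t₂ = K` in the roots of
  `3t² + (18−K)t + 3K`, tangency iff `K² − 72K + 324 = 0`; the `ω`-rotated components give
  the norm form `q₄(K) = K⁴+72K³+4860K²+23328K+104976`; neither vanishes at `K = 25, −16, −720`;
* `psi_degree_bound`, `hecke_path_count_first`, `hecke_path_count_higher`,
  `hecke_path_count_4_2` : the degree count `deg_T Ψ_{N,K} = 8ψ(N)` (a monomial `XᵃYᵇ` of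
  `Φ_N` contributes degree `7ψ + a − b`) and the path counts used to strip backtracking from
  resultants of modular polynomials (`ψ(ℓ)(ℓ+1) = ψ(ℓ²) + (ℓ+1)`,
  `ψ(ℓᵉ)(ℓ+1) = ψ(ℓᵉ⁺¹) + ℓ·ψ(ℓᵉ⁻¹)` for `e ≥ 2`, `ψ(4)·ψ(2) = ψ(8) + 2ψ(2)`);
* `torus_period_hadamard`, `torus_period_small` : `(6n)! = C(6n,3n)·(3n)!·(3n)!`, i.e.
  `A_n = (6n)!/n!⁶ = C(6n,3n)·((3n)!/n!³)²` — the `A`-invariant period of `X_ψ` is a Hadamard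
  product of two Hesse-pencil periods with a central-binomial factor (LEMMA HH), with the
  instances `n = 1, 2`.
-/

set_option linter.dupNamespace false
set_option linter.style.longLine false

namespace Summit.HodgeConjecture.HodgeConjecture.Theorems.HesseHecke

/-! ## The Hesse Hauptmodul and its level-3 involution -/

/-- Ramification over `j = 1728`: with `s = t³`, the numerator of `j − 1728` is a perfect square. -/
theorem hesse_j_sub_1728_square (s : ℤ) :
    s * (s + 216) ^ 3 - 1728 * (s - 27) ^ 3 = (s ^ 2 - 540 * s - 5832) ^ 2 := by
  ring

/-- The Möbius map `g(t) = (3t+18)/(t−3)` of the Hesse parameter line. -/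
def hesseInv (t : ℚ) : ℚ := (3 * t + 18) / (t - 3)

/-- `g` is an involution away from its pole `t = 3` (note `g(t) − 3 = 27/(t−3) ≠ 0`). -/
theorem hesse_involution_involutive (t : ℚ) (ht : t ≠ 3) : hesseInv (hesseInv t) = t := by
  unfold hesseInv
  have h3 : t - 3 ≠ 0 := sub_ne_zero.mpr ht
  have hden : (3 * t + 18) / (t - 3) - 3 ≠ 0 := by
    rw [div_sub' (hc := h3)]
    exact div_ne_zero (by ring_nf; norm_num) h3
  rw [div_eq_iff hden]
  field_simp
  ring

/-- `g` swaps the cusps `3ω` and `3ω²` of the Hesse pencil (`ω² + ω + 1 = 0`):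
`g(3ω) = (9ω+18)/(3ω−3) = 3ω²`, in cross-multiplied form. -/
theorem hesse_involution_swaps_cusps {R : Type*} [CommRing R] (ω : R) (h : ω ^ 2 + ω + 1 = 0) :
    9 * ω + 18 = 3 * ω ^ 2 * (3 * ω - 3) := by
  linear_combination (18 - 9 * ω) * h

/-- `j(g(t)) = j(t)` for `j(t) = t³(t³+216)³/(t³−27)³`, cross-multiplied (both sides have degree 21:
`(3t+18)³ − 27(t−3)³` is quadratic). -/
theorem hesse_j_invariant (t : ℚ) :
    (3 * t + 18) ^ 3 * ((3 * t + 18) ^ 3 + 216 * (t - 3) ^ 3) ^ 3 * (t ^ 3 - 27) ^ 3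
      = t ^ 3 * (t ^ 3 + 216) ^ 3 * (t - 3) ^ 3 * ((3 * t + 18) ^ 3 - 27 * (t - 3) ^ 3) ^ 3 := by
  ring

/-! ## Level 1: the planted positive and the RM points -/

/-- On the hyperbola `t₁t₂ = K` the component `t₂ = g(t₁)` is cut out by `3t² + (18−K)t + 3K`
(`t·(3t+18) = K·(t−3)`), whose discriminant is `K² − 72K + 324`. -/
theorem level_one_tangency_discriminant (K t : ℚ) :
    (t * (3 * t + 18) - K * (t - 3) = 3 * t ^ 2 + (18 - K) * t + 3 * K) ∧
    ((18 - K) ^ 2 - 4 * 3 * (3 * K) = K ^ 2 - 72 * K + 324) := by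
  constructor <;> ring

/-- The `ω`-rotated components `t₂ = ωᵃ g(ωᵇ t₁)` have discriminants `ω^{2c}·(k² − 72k + 324)` at
`k = Kω^{-c}`; the product over `c = 1, 2` is the rational quartic `q₄`. -/
theorem level_one_tangency_norm_form {R : Type*} [CommRing R] (K ω : R) (h : ω ^ 2 + ω + 1 = 0) :
    (K ^ 2 - 72 * K * ω + 324 * ω ^ 2) * (K ^ 2 - 72 * K * ω ^ 2 + 324 * ω)
      = K ^ 4 + 72 * K ^ 3 + 4860 * K ^ 2 + 23328 * K + 104976 := by
  linear_combination
    ((-72 * K ^ 3 - 4860 * K ^ 2 - 23328 * K - 104976) + (5184 * K ^ 2 + 23328 * K + 104976) * ω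
      - 23328 * K * ω ^ 2) * h

/-- At the three RM points `K = ψ²/4 ∈ {25, −16, −720}` no level-1 component is tangent to the
branch hyperbola: `(K² − 72K + 324)·q₄(K) ≠ 0`. -/
theorem rm_points_not_level_one_tangent :
    ∀ K ∈ ({25, -16, -720} : Finset ℚ),
      (K ^ 2 - 72 * K + 324) * (K ^ 4 + 72 * K ^ 3 + 4860 * K ^ 2 + 23328 * K + 104976) ≠ 0 := by
  intro K hK
  simp only [Finset.mem_insert, Finset.mem_singleton] at hK
  rcases hK with rfl | rfl | rfl <;> norm_num

/-! ## Degree and path counts behind `Ψ_{N,K}` and the composite modular polynomials -/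

/-- A monomial `XᵃYᵇ` of `Φ_N` (`a ≤ ψ`) contributes degree `7ψ + a − b ≤ 8ψ` to `Ψ_{N,K}(T)`,
with equality only for `(a,b) = (ψ,0)` (stated over `ℤ`, `0 ≤ b`, to avoid truncated subtraction). -/
theorem psi_degree_bound (ψ a b : ℤ) (ha : a ≤ ψ) (hb : 0 ≤ b) :
    7 * ψ + a - b ≤ 8 * ψ ∧ (7 * ψ + a - b = 8 * ψ ↔ a = ψ ∧ b = 0) := by
  constructor
  · omega
  · constructor
    · intro h; constructor <;> omega
    · rintro ⟨rfl, rfl⟩; ring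

/-- Paths `ℓ ∘ ℓ`: `ψ(ℓ)·(ℓ+1) = ψ(ℓ²) + (ℓ+1)·ψ(1)` (backtracking factor `(x−z)^{ℓ+1}`). -/
theorem hecke_path_count_first (l : ℕ) : (l + 1) * (l + 1) = l * (l + 1) + (l + 1) * 1 := by
  ring

/-- Paths `ℓᵉ ∘ ℓ`, `e ≥ 2`: `ψ(ℓᵉ)(ℓ+1) = ψ(ℓᵉ⁺¹) + ℓ·ψ(ℓᵉ⁻¹)` with `ψ(ℓᵉ) = ℓᵉ⁻¹(ℓ+1)`
(backtracking factor `Φ_{ℓᵉ⁻¹}(x,z)^ℓ`), written with `e = d + 2`. -/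
theorem hecke_path_count_higher (l d : ℕ) :
    l ^ (d + 1) * (l + 1) * (l + 1) = l ^ (d + 2) * (l + 1) + l * (l ^ d * (l + 1)) := by
  ring

/-- The instance used for `Φ₈ = Res_y(Φ₄, Φ₂)/Φ₂(x,z)²`: `ψ(4)ψ(2) = 6·3 = 12 + 2·3 = ψ(8) + 2ψ(2)`,
and for `Φ₉ = Res_y(Φ₃,Φ₃)/(x−z)⁴`: `4·4 = 12 + 4`. -/
theorem hecke_path_count_4_2 : 6 * 3 = 12 + 2 * 3 ∧ 4 * 4 = 12 + 4 := by
  norm_num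

/-! ## The torus period: Hadamard structure of `A_n = (6n)!/n!⁶` -/

/-- `(6n)! = C(6n,3n)·(3n)!·(3n)!`, i.e. `A_n = (6n)!/n!⁶ = C(6n,3n)·((3n)!/n!³)²`. -/
theorem torus_period_hadamard (n : ℕ) :
    Nat.choose (6 * n) (3 * n) * Nat.factorial (3 * n) * Nat.factorial (3 * n) = Nat.factorial (6 * n) := by
  have h := Nat.choose_mul_factorial_mul_factorial (show 3 * n ≤ 6 * n by omega)
  have h' : 6 * n - 3 * n = 3 * n := by omega
  rw [h'] at h
  exact h

/-- Instances `n = 1, 2`: `A₁ = 720 = 20·6²`, `A₂ = 7484400 = 924·90²`. -/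
theorem torus_period_small :
    Nat.factorial 6 = 720 ∧ Nat.choose 6 3 * 6 ^ 2 = 720 ∧
    Nat.factorial 12 = 7484400 * 2 ^ 6 ∧ Nat.choose 12 6 * 90 ^ 2 = 7484400 ∧
    Nat.factorial 6 = 90 * Nat.factorial 2 ^ 3 := by
  refine ⟨by decide, by decide, ?_, by decide, by decide⟩
  simp [Nat.factorial]

end Summit.HodgeConjecture.HodgeConjecture.Theorems.HesseHecke
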